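import Summits.Ventures.GridStability.Models.WSCC9FaultOnTube

/-!
# WSCC9FaultOnTubeRestart — the bus-7 fault-on kernel tube of the WSCC 3-machine model RESTARTED at `t = 1/12 s` and carried to `t = 23/200 s` (rider «#61‴ LOWER-K ∀ t_cl ≤ 23/200 s», shape (β))

Venture GRIDFUSION (LADDER-GRIDFUSION G1-cct; lead g5 RULING 5l (3) 2026-08-27T10:23:22Z: «model-1: GO on the (β) restart
tube — ONE restarted tube on [1/12, 23/200] from the K(1/12) box, Tube9 template + lit-1 p501879 secondOrder_tube_restart»),
seat gridfusion-model-1.  Moore's step-by-step continuation (§8.1, after (8.5)): the a-priori enclosure is re-based at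
`a = 1/12` on the state box `K(1/12)` certified by `WSCC9.faultBus7_tube` (p510936) and continued for `τ = T − 1/12 ≤ 19/600`
with NEW kernel field bounds on the (much tighter) restart box
`B_R = [0.0005, 0.007] × [0.46, 0.63] × [0.27, 0.39]` (angles, reference angle `δ₁(0)` translated to `0`) `× [0.02, 0.12] ×
[3.9, 5.55] × [1.95, 3.45]` (printed speeds): on `B_R` the angle difference `a3 ∈ [0.263, 0.3895]` (`sin ∈ [0.2599, 0.3798]`,
`cos ∈ [0.9229, 0.9657]` by `Real.sin_bound` / `Real.cos_bound`), whence `tubeLoR = (337/500, 23449/500, 20249/1000) =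
(0.674, 46.898, 20.249)`, `tubeHiR = (679/500, 47229/1000, 2599/100) = (1.358, 47.229, 25.99)` rad/s² (outward 3-dp); the four
strict restart inclusions at `τ = 19/600` are rational inequalities in the `K(1/12)` corners.
STATEMENT `faultBus7_tube_restart`: for every `T ∈ [1/12, 23/200]`, every solution `Y` of `faultBus7Printed` on `[0, T]` from the
printed pre-fault point at rest, every `t ∈ [1/12, T]`, machine-wise: `tubeLoR_i (t − 1/12) ≤ ω_i(t) − ω_i(1/12) ≤
tubeHiR_i (t − 1/12)` and `tubeLoR_i (t − 1/12)²/2 ≤ δ_i(t) − δ_i(1/12) − ω_i(1/12)(t − 1/12) ≤ tubeHiR_i (t − 1/12)²/2`; together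
with `faultBus7_state_at_1_12` (the `K(1/12)` box: `Δδ_i(1/12) ∈ [tubeLo_i, tubeHi_i]/288`, `ω_i(1/12) ∈ [tubeLo_i, tubeHi_i]/12`)
this gives the slice hulls on `[1/12, 23/200]` for the «K ⊂ S» consumer (sos-1 certificates, sos-3 typing).  THREE COLUMNS:
CERTIFIED = tube sentence for MODEL M′ (classical WSCC9, MV-2 + MV-P + MV-SPD + MV-h12, bolted fault at bus 7); VALIDATED =
model-4's tube-T0833-T115 packet; no stability claim.  [cite: Moore1979, §8.1 eqs. (8.5), (8.10) and the step-by-step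
continuation after (8.5); AndersonFouad1977, Example 2.6 / §2.10]
-/

noncomputable section

open Real Set Finset

namespace Summit.Ventures.GridStability.Models

namespace WSCC9

/-- Restart-leg lower acceleration bounds (rad/s²) on `[1/12, 23/200]`, machines 1, 2, 3: `(0.674, 46.898, 20.249)`. -/
def tubeLoR : Fin 3 → ℝ := ![337 / 500, 23449 / 500, 20249 / 1000]

/-- Restart-leg upper acceleration bounds (rad/s²) on `[1/12, 23/200]`, machines 1, 2, 3: `(1.358, 47.229, 25.99)`. -/
def tubeHiR : Fin 3 → ℝ := ![679 / 500, 47229 / 1000, 2599 / 100]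

/-- Restart box `B_R`, angle lower corners (reference angle translated to `0`). -/
def boxAR : Fin 3 → ℝ := ![1 / 2000, 23 / 50, 27 / 100]
/-- Restart box `B_R`, angle upper corners. -/
def boxBR : Fin 3 → ℝ := ![7 / 1000, 63 / 100, 39 / 100]
/-- Restart box `B_R`, printed-speed lower corners. -/
def boxCR : Fin 3 → ℝ := ![1 / 50, 39 / 10, 39 / 20]
/-- Restart box `B_R`, printed-speed upper corners. -/
def boxDR : Fin 3 → ℝ := ![3 / 25, 111 / 20, 69 / 20]

/-- `sin`/`cos` enclosures on `[0.263, 0.3895]` (monotonicity + `Real.sin_bound` / `Real.cos_bound`). -/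
theorem trig_bounds_a3_R {s : ℝ} (hs : s ∈ Icc (263 / 1000 : ℝ) (779 / 2000)) :
    (0.2599 : ℝ) ≤ Real.sin s ∧ Real.sin s ≤ 0.3798 ∧ (0.9229 : ℝ) ≤ Real.cos s ∧ Real.cos s ≤ 0.9657 := by
  obtain ⟨h1, h2⟩ := hs
  have hπ := Real.pi_gt_three
  have hsin_lo : Real.sin (263 / 1000) ≤ Real.sin s :=
    Real.sin_le_sin_of_le_of_le_pi_div_two (by linarith) (by linarith) h1
  have hsin_hi : Real.sin s ≤ Real.sin (779 / 2000) :=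
    Real.sin_le_sin_of_le_of_le_pi_div_two (by linarith) (by linarith) h2
  have hcos_hi : Real.cos s ≤ Real.cos (263 / 1000) :=
    Real.cos_le_cos_of_nonneg_of_le_pi (by norm_num) (by linarith) h1
  have hcos_lo : Real.cos (779 / 2000) ≤ Real.cos s :=
    Real.cos_le_cos_of_nonneg_of_le_pi (by linarith) (by linarith) h2
  have b1 := Real.sin_bound (x := (263 / 1000 : ℝ)) (by rw [abs_of_nonneg (by norm_num)]; norm_num)
  have b2 := Real.sin_bound (x := (779 / 2000 : ℝ)) (by rw [abs_of_nonneg (by norm_num)]; norm_num)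
  have b3 := Real.cos_bound (x := (263 / 1000 : ℝ)) (by rw [abs_of_nonneg (by norm_num)]; norm_num)
  have b4 := Real.cos_bound (x := (779 / 2000 : ℝ)) (by rw [abs_of_nonneg (by norm_num)]; norm_num)
  rw [abs_of_nonneg (by norm_num : (0 : ℝ) ≤ 263 / 1000)] at b1 b3
  rw [abs_of_nonneg (by norm_num : (0 : ℝ) ≤ 779 / 2000)] at b2 b4
  obtain ⟨b1l, b1u⟩ := abs_le.1 b1
  obtain ⟨b2l, b2u⟩ := abs_le.1 b2
  obtain ⟨b3l, b3u⟩ := abs_le.1 b3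
  obtain ⟨b4l, b4u⟩ := abs_le.1 b4
  norm_num at b1l b1u b2l b2u b3l b3u b4l b4u ⊢
  refine ⟨by linarith, by linarith, by linarith, by linarith⟩

/-- **Kernel field bounds on the restart box `B_R`.** -/
theorem faultBus7Printed_fieldBoundsR (x : ClassicalSwing.State 3)
    (hx : ∀ i, boxAR i ≤ x.1 i ∧ x.1 i ≤ boxBR i ∧ boxCR i ≤ x.2 i ∧ x.2 i ≤ boxDR i) :
    ∀ i, tubeLoR i ≤ (faultBus7Printed.field x).2 i ∧ (faultBus7Printed.field x).2 i ≤ tubeHiR i := by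
  have h0 := hx 0
  have h1 := hx 1
  have h2 := hx 2
  simp only [boxAR, boxBR, boxCR, boxDR, Matrix.cons_val_zero, Matrix.cons_val_one, Matrix.head_cons,
    Matrix.cons_val_two, Matrix.tail_cons] at h0 h1 h2
  have ha3 : x.1 2 - x.1 0 ∈ Icc (263 / 1000 : ℝ) (779 / 2000) := ⟨by linarith, by linarith⟩
  obtain ⟨hs1, hs2, hc1, hc2⟩ := trig_bounds_a3_R ha3
  have hsin' : Real.sin (x.1 0 - x.1 2) = -Real.sin (x.1 2 - x.1 0) := by
    rw [← Real.sin_neg]; ring_nf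
  have hcos' : Real.cos (x.1 0 - x.1 2) = Real.cos (x.1 2 - x.1 0) := by
    rw [← Real.cos_neg]; ring_nf
  have hm0 : tubeLoR 0 ≤ (faultBus7Printed.field x).2 0 ∧ (faultBus7Printed.field x).2 0 ≤ tubeHiR 0 := by
    rw [faultBus7Printed_field_snd, faultBus7_Pe_zero, hsin', hcos']
    simp only [tubeLoR, tubeHiR, Pprinted, D_SP, M, Matrix.cons_val_zero]
    push_cast
    constructor
    · rw [le_div_iff₀ (by norm_num)]; nlinarith
    · rw [div_le_iff₀ (by norm_num)]; nlinarith
  have hm1 : tubeLoR 1 ≤ (faultBus7Printed.field x).2 1 ∧ (faultBus7Printed.field x).2 1 ≤ tubeHiR 1 := by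
    rw [faultBus7Printed_field_snd, faultBus7_Pe_one]
    simp only [tubeLoR, tubeHiR, Pprinted, D_SP, M, Matrix.cons_val_one]
    push_cast
    constructor
    · rw [le_div_iff₀ (by norm_num)]; nlinarith
    · rw [div_le_iff₀ (by norm_num)]; nlinarith
  have hm2 : tubeLoR 2 ≤ (faultBus7Printed.field x).2 2 ∧ (faultBus7Printed.field x).2 2 ≤ tubeHiR 2 := by
    rw [faultBus7Printed_field_snd, faultBus7_Pe_two]
    simp only [tubeLoR, tubeHiR, Pprinted, D_SP, M, Matrix.cons_val_two, Matrix.tail_cons,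
      Matrix.head_cons]
    push_cast
    constructor
    · rw [le_div_iff₀ (by norm_num)]; nlinarith
    · rw [div_le_iff₀ (by norm_num)]; nlinarith
  intro i
  fin_cases i
  · exact hm0
  · exact hm1
  · exact hm2

/-- **The state at `t = 1/12 s`** of a fault-on solution on `[0, T]`, `T ≥ 1/12` (restriction of `faultBus7_tube`):
`tubeLo_i/288 ≤ δ_i(1/12) − δ_i(0) ≤ tubeHi_i/288` and `tubeLo_i/12 ≤ ω_i(1/12) ≤ tubeHi_i/12` — the box `K(1/12)`. -/
theorem faultBus7_state_at_1_12 {T : ℝ} (hT1 : 1 / 12 ≤ T) {Y : ℝ → ClassicalSwing.State 3}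
    (hY : faultBus7Printed.IsSolutionOn Y (Icc 0 T)) (hω0 : (Y 0).2 = 0)
    (ha2 : (Y 0).1 1 - (Y 0).1 0 ∈ a2Window) (ha3 : (Y 0).1 2 - (Y 0).1 0 ∈ a3Window) :
    ∀ i : Fin 3, tubeLo i / 12 ≤ (Y (1 / 12)).2 i ∧ (Y (1 / 12)).2 i ≤ tubeHi i / 12 ∧
      tubeLo i / 288 ≤ (Y (1 / 12)).1 i - (Y 0).1 i ∧ (Y (1 / 12)).1 i - (Y 0).1 i ≤ tubeHi i / 288 := by
  have hY' : faultBus7Printed.IsSolutionOn Y (Icc 0 (1 / 12)) := fun t ht =>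
    (hY t ⟨ht.1, ht.2.trans hT1⟩).mono (Icc_subset_Icc_right hT1)
  intro i
  obtain ⟨k1, k2, k3, k4⟩ := faultBus7_tube (T := 1 / 12) (by norm_num) le_rfl hY' hω0 ha2 ha3 (1 / 12)
    ⟨by norm_num, le_rfl⟩ i
  refine ⟨by linarith, by linarith, by linarith, by linarith⟩

/-- **THE RESTARTED FAULT-ON TUBE on `[1/12, 23/200] s` («bus 7 grounded», printed frame).**  For every `T ∈ [1/12, 23/200]`,
every solution `Y` of `faultBus7Printed` on `[0, T]` with `ω(0) = 0` from the printed pre-fault relative angles, and every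
`t ∈ [1/12, T]`, machine-wise: `tubeLoR_i·(t − 1/12) ≤ ω_i(t) − ω_i(1/12) ≤ tubeHiR_i·(t − 1/12)` and
`tubeLoR_i·(t − 1/12)²/2 ≤ δ_i(t) − δ_i(1/12) − ω_i(1/12)·(t − 1/12) ≤ tubeHiR_i·(t − 1/12)²/2`.  Moore's step-by-step
continuation: lit-1's `secondOrder_tube_restart` re-based at `a = 1/12` on the box `K(1/12)` of `faultBus7_state_at_1_12`, with the
kernel field bounds `faultBus7Printed_fieldBoundsR` on `B_R`.  MODELLED: classical WSCC9 fault-on model M′.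
[cite: Moore1979, §8.1 (step-by-step continuation after (8.5)), eq. (8.10); AndersonFouad1977, Example 2.6] -/
theorem faultBus7_tube_restart {T : ℝ} (hT1 : 1 / 12 ≤ T) (hT2 : T ≤ 23 / 200) {Y : ℝ → ClassicalSwing.State 3}
    (hY : faultBus7Printed.IsSolutionOn Y (Icc 0 T)) (hω0 : (Y 0).2 = 0)
    (ha2 : (Y 0).1 1 - (Y 0).1 0 ∈ a2Window) (ha3 : (Y 0).1 2 - (Y 0).1 0 ∈ a3Window) :
    ∀ t ∈ Icc (1 / 12) T, ∀ i : Fin 3,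
      tubeLoR i * (t - 1 / 12) ≤ (Y t).2 i - (Y (1 / 12)).2 i ∧ (Y t).2 i - (Y (1 / 12)).2 i ≤ tubeHiR i * (t - 1 / 12) ∧
        tubeLoR i * (t - 1 / 12) ^ 2 / 2 ≤ (Y t).1 i - (Y (1 / 12)).1 i - (Y (1 / 12)).2 i * (t - 1 / 12) ∧
          (Y t).1 i - (Y (1 / 12)).1 i - (Y (1 / 12)).2 i * (t - 1 / 12) ≤ tubeHiR i * (t - 1 / 12) ^ 2 / 2 := by
  have hT0 : (0 : ℝ) ≤ T := by linarith
  -- the state box at 1/12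
  have hK := faultBus7_state_at_1_12 hT1 hY hω0 ha2 ha3
  obtain ⟨w0l, w0u, d0l, d0u⟩ := hK 0
  obtain ⟨w1l, w1u, d1l, d1u⟩ := hK 1
  obtain ⟨w2l, w2u, d2l, d2u⟩ := hK 2
  simp only [tubeLo, tubeHi, Matrix.cons_val_zero, Matrix.cons_val_one, Matrix.head_cons, Matrix.cons_val_two,
    Matrix.tail_cons] at w0l w0u d0l d0u w1l w1u d1l d1u w2l w2u d2l d2u
  obtain ⟨ha2l, ha2u⟩ := ha2
  obtain ⟨ha3l, ha3u⟩ := ha3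
  norm_num at ha2l ha2u ha3l ha3u
  -- component curves, reference angle translated to 0
  set r : ℝ := (Y 0).1 0 with hr
  set q : ℝ → Fin 3 → ℝ := fun s j => (Y s).1 j - r with hq
  set v : ℝ → Fin 3 → ℝ := fun s j => (Y s).2 j with hv
  set G : ℝ → Fin 3 → ℝ := fun s j => (faultBus7Printed.field (Y s)).2 j with hG
  have hqd : ∀ i, ∀ t ∈ Icc 0 T, HasDerivWithinAt (fun s => q s i) (v t i) (Icc 0 T) t := by
    intro i t ht
    have h1 : HasDerivWithinAt (fun s => (Y s).1) ((faultBus7Printed.field (Y t)).1) (Icc 0 T) t :=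
      (ContinuousLinearMap.fst ℝ (Fin 3 → ℝ) (Fin 3 → ℝ)).hasFDerivAt.comp_hasDerivWithinAt t (hY t ht)
    have h2 := (hasDerivWithinAt_pi.1 h1 i).sub_const r
    simpa [hq, hv, ClassicalSwing.field] using h2
  have hvd : ∀ i, ∀ t ∈ Icc 0 T, HasDerivWithinAt (fun s => v s i) (G t i) (Icc 0 T) t := by
    intro i t ht
    have h1 : HasDerivWithinAt (fun s => (Y s).2) ((faultBus7Printed.field (Y t)).2) (Icc 0 T) t :=
      (ContinuousLinearMap.snd ℝ (Fin 3 → ℝ) (Fin 3 → ℝ)).hasFDerivAt.comp_hasDerivWithinAt t (hY t ht)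
    exact hasDerivWithinAt_pi.1 h1 i
  -- field bounds along the motion while in B_R (translation invariance of P_e)
  have hGB : ∀ t ∈ Icc (1 / 12) T, (∀ i, boxAR i ≤ q t i ∧ q t i ≤ boxBR i ∧ boxCR i ≤ v t i ∧ v t i ≤ boxDR i) →
      ∀ i, tubeLoR i ≤ G t i ∧ G t i ≤ tubeHiR i := by
    intro t _ hB i
    have hPe : ∀ j, faultBus7Printed.Pe (fun k => (Y t).1 k - r) j = faultBus7Printed.Pe (Y t).1 j := by
      intro j
      have := Pe_add_const faultBus7Printed (Y t).1 (-r) j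
      simpa [sub_eq_add_neg] using this
    have hfield : (faultBus7Printed.field ((fun k => (Y t).1 k - r), (Y t).2)).2 i =
        (faultBus7Printed.field (Y t)).2 i := by
      simp only [ClassicalSwing.field, hPe]
    have key := faultBus7Printed_fieldBoundsR ((fun k => (Y t).1 k - r), (Y t).2) hB i
    rw [hfield] at key
    simpa [hG] using key
  -- the four strict restart inclusions at τ = T − 1/12 ≤ 19/600
  have hτ0 : 0 ≤ T - 1 / 12 := by linarith
  have hτ1 : T - 1 / 12 ≤ 19 / 600 := by linarith
  obtain ⟨τ, hτ⟩ : ∃ τ : ℝ, T - 1 / 12 = τ := ⟨_, rfl⟩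
  rw [hτ] at hτ0 hτ1
  have hτ2 : τ ^ 2 ≤ 361 / 360000 := by nlinarith
  have hq0 : q (1 / 12) 0 = (Y (1 / 12)).1 0 - (Y 0).1 0 := rfl
  have hq1 : q (1 / 12) 1 = ((Y (1 / 12)).1 1 - (Y 0).1 1) + ((Y 0).1 1 - (Y 0).1 0) := by
    show (Y (1 / 12)).1 1 - (Y 0).1 0 = _; ring
  have hq2 : q (1 / 12) 2 = ((Y (1 / 12)).1 2 - (Y 0).1 2) + ((Y 0).1 2 - (Y 0).1 0) := by
    show (Y (1 / 12)).1 2 - (Y 0).1 0 = _; ring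
  have hv0 : v (1 / 12) 0 = (Y (1 / 12)).2 0 := rfl
  have hv1 : v (1 / 12) 1 = (Y (1 / 12)).2 1 := rfl
  have hv2 : v (1 / 12) 2 = (Y (1 / 12)).2 2 := rfl
  have hloR : (0 : ℝ) < tubeLoR 0 ∧ (0 : ℝ) < tubeLoR 1 ∧ (0 : ℝ) < tubeLoR 2 := by
    simp only [tubeLoR, Matrix.cons_val_zero, Matrix.cons_val_one, Matrix.head_cons, Matrix.cons_val_two,
      Matrix.tail_cons]; norm_num
  have hhiR : (0 : ℝ) < tubeHiR 0 ∧ (0 : ℝ) < tubeHiR 1 ∧ (0 : ℝ) < tubeHiR 2 := by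
    simp only [tubeHiR, Matrix.cons_val_zero, Matrix.cons_val_one, Matrix.head_cons, Matrix.cons_val_two,
      Matrix.tail_cons]; norm_num
  have hvpos : ∀ i, 0 ≤ v (1 / 12) i := by
    intro i; fin_cases i
    · rw [show v (1 / 12) ((fun i => i) ⟨0, by norm_num⟩) = (Y (1 / 12)).2 0 from rfl]; linarith
    · rw [show v (1 / 12) ((fun i => i) ⟨1, by norm_num⟩) = (Y (1 / 12)).2 1 from rfl]; linarith
    · rw [show v (1 / 12) ((fun i => i) ⟨2, by norm_num⟩) = (Y (1 / 12)).2 2 from rfl]; linarith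
  have hminv : ∀ i, min 0 (v (1 / 12) i * (T - 1 / 12)) = 0 := fun i =>
    min_eq_left (mul_nonneg (hvpos i) (by rw [hτ]; exact hτ0))
  have hmaxv : ∀ i, max 0 (v (1 / 12) i * (T - 1 / 12)) = v (1 / 12) i * (T - 1 / 12) := fun i =>
    max_eq_right (mul_nonneg (hvpos i) (by rw [hτ]; exact hτ0))
  have hminlo : ∀ i, min (tubeLoR i) 0 = 0 := by
    intro i; fin_cases i
    · exact min_eq_right hloR.1.le
    · exact min_eq_right hloR.2.1.le
    · exact min_eq_right hloR.2.2.le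
  have hmaxhi : ∀ i, max (tubeHiR i) 0 = tubeHiR i := by
    intro i; fin_cases i
    · exact max_eq_left hhiR.1.le
    · exact max_eq_left hhiR.2.1.le
    · exact max_eq_left hhiR.2.2.le
  have hKa : ∀ i, boxAR i < q (1 / 12) i + min 0 (v (1 / 12) i * (T - 1 / 12)) + min (tubeLoR i) 0 * (T - 1 / 12) ^ 2 / 2 := by
    intro i; rw [hminv, hminlo]; simp only [add_zero, zero_mul, zero_div]
    fin_cases i
    · show boxAR 0 < q (1 / 12) 0
      rw [hq0]; simp only [boxAR, Matrix.cons_val_zero]; linarith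
    · show boxAR 1 < q (1 / 12) 1
      rw [hq1]; norm_num [boxAR, Matrix.cons_val_one, Matrix.head_cons]; linarith
    · show boxAR 2 < q (1 / 12) 2
      rw [hq2]; simp only [boxAR, Matrix.cons_val_two, Matrix.tail_cons, Matrix.head_cons]; linarith
  have hKb : ∀ i, q (1 / 12) i + max 0 (v (1 / 12) i * (T - 1 / 12)) + max (tubeHiR i) 0 * (T - 1 / 12) ^ 2 / 2 < boxBR i := by
    intro i; rw [hmaxv, hmaxhi, hτ]
    fin_cases i
    · show q (1 / 12) 0 + v (1 / 12) 0 * τ + tubeHiR 0 * τ ^ 2 / 2 < boxBR 0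
      rw [hq0, hv0]; simp only [boxBR, tubeHiR, Matrix.cons_val_zero]
      have p1 : (Y (1 / 12)).2 0 * τ ≤ 223 / 250 / 12 * (19 / 600) := mul_le_mul w0u hτ1 hτ0 (by norm_num)
      linarith [p1, hτ2]
    · show q (1 / 12) 1 + v (1 / 12) 1 * τ + tubeHiR 1 * τ ^ 2 / 2 < boxBR 1
      rw [hq1, hv1]; norm_num [boxBR, tubeHiR, Matrix.cons_val_one, Matrix.head_cons]
      have p1 : (Y (1 / 12)).2 1 * τ ≤ 48009 / 1000 / 12 * (19 / 600) := mul_le_mul w1u hτ1 hτ0 (by norm_num)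
      linarith [p1, hτ2]
    · show q (1 / 12) 2 + v (1 / 12) 2 * τ + tubeHiR 2 * τ ^ 2 / 2 < boxBR 2
      rw [hq2, hv2]; simp only [boxBR, tubeHiR, Matrix.cons_val_two, Matrix.tail_cons, Matrix.head_cons]
      have p1 : (Y (1 / 12)).2 2 * τ ≤ 29611 / 1000 / 12 * (19 / 600) := mul_le_mul w2u hτ1 hτ0 (by norm_num)
      linarith [p1, hτ2]
  have hKc : ∀ i, boxCR i < v (1 / 12) i + min (tubeLoR i) 0 * (T - 1 / 12) := by
    intro i; rw [hminlo]; simp only [zero_mul, add_zero]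
    fin_cases i
    · show boxCR 0 < v (1 / 12) 0
      rw [hv0]; simp only [boxCR, Matrix.cons_val_zero]; linarith
    · show boxCR 1 < v (1 / 12) 1
      rw [hv1]; norm_num [boxCR, Matrix.cons_val_one, Matrix.head_cons]; linarith
    · show boxCR 2 < v (1 / 12) 2
      rw [hv2]; simp only [boxCR, Matrix.cons_val_two, Matrix.tail_cons, Matrix.head_cons]; linarith
  have hKd : ∀ i, v (1 / 12) i + max (tubeHiR i) 0 * (T - 1 / 12) < boxDR i := by
    intro i; rw [hmaxhi, hτ]
    fin_cases i
    · show v (1 / 12) 0 + tubeHiR 0 * τ < boxDR 0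
      rw [hv0]; simp only [boxDR, tubeHiR, Matrix.cons_val_zero]; linarith
    · show v (1 / 12) 1 + tubeHiR 1 * τ < boxDR 1
      rw [hv1]; norm_num [boxDR, tubeHiR, Matrix.cons_val_one, Matrix.head_cons]; linarith
    · show v (1 / 12) 2 + tubeHiR 2 * τ < boxDR 2
      rw [hv2]; simp only [boxDR, tubeHiR, Matrix.cons_val_two, Matrix.tail_cons, Matrix.head_cons]; linarith
  have key := Literature.Analysis.ODE.secondOrder_tube_restart (a := 1 / 12) (by norm_num) hT1 hqd hvd hGB
    hKa hKb hKc hKd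
  intro t ht i
  obtain ⟨k1, k2, k3, k4⟩ := key t ht i
  have e1 : v t i - v (1 / 12) i = (Y t).2 i - (Y (1 / 12)).2 i := rfl
  have e2 : q t i - q (1 / 12) i - v (1 / 12) i * (t - 1 / 12) =
      (Y t).1 i - (Y (1 / 12)).1 i - (Y (1 / 12)).2 i * (t - 1 / 12) := by
    simp only [hq, hv]; ring
  rw [e1] at k1 k2
  rw [e2] at k3 k4
  exact ⟨k1, k2, k3, k4⟩

end WSCC9

end Summit.Ventures.GridStability.Models

end
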